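import Summits.QuantumFields.YangMills.Theorems.BalabanUVNodesN09B0RiderAtRecord
import Literature.MathematicalPhysics.QuantumFieldTheory.Balaban1983to89.Node00.RegSetOfFibredChart

/-!
# NODE N09 [B12] — THE ANALYTIC INCLUSION `hreg` OF THE THEOREM-3 DOORS AT THE STAGE-13 RECORD FROM PER-STEP FIBRED CHARTS OF THE AVERAGING OF RECORD
# ([I] (2.10)'s shape): dag-n09-w4 g3's small-field-bookkeeping door with `hreg` REPLACED by displayed chart data

Cell `pub-ymgap` (YM-PLAN Track A), width seat `pub-ymgap-dag-n09-w6` g2 (D-0149 width seat 6 of node N09); helper of K1⁷ `StabilityBAtRecordR13SepCoPH` =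
stmt-QuantumFields-20542 (`--supports`, `--as helper`, count-neutral).  [I] = [Balaban1987RG1] (CMP 109), [B11] = [Balaban1985Variational].

WHY.  N09's Theorem-3 member at the Stage-13 record, in dag-n09-w3 g2's door with the small-field DOMAINS as bookkeeping sets and dag-n09-w4 g3's rider discharge
(`…N09B0RiderAtRecord.thm3Member_stage13SepCoPH_atDomAlt_of_numerics_of_εreg_eq`, p607274 ✓), displays exactly TWO analytic hypotheses: (I19) `hint` (integrability
of the β-input densities) and THE ANALYTIC INCLUSION `hreg : ∀ j < K, domAlt_{j+1} ⊆ regSetOfRecord K j ρ_j` — «the transform of the (0.19) density `ρ_j` has a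
continuous version on the small-field domain of the next step» ([I] p. 259 «effective actions for small fields»; K0e's located debt (F1)).  Print obtains that continuity
from the substitution (2.10) p. 267: after the linearisation `B₁ = B′ − hD_W(B′)` the δ-constraint integral becomes an integral over a FIXED domain of a jointly continuous
integrand.  This seat's Literature module `Node00.RegSetOfFibredChart` (p609712 ✓) typed the measure-theoretic skeleton of that step: a DISPLAYED fibred chart
`(Z, τ, Φ, J, S)` of the averaging of record over an open set `U` on the support of `ρ` with the change-of-variables identity
`dU⌊(Ū⁻¹U ∩ S) = Φ_*((dV⌊U ⊗ τ)·J)` and a fibre integral continuous on `U` puts `U` inside `regSetOfRecord` (`domAlt_subset_regSetOfRecord_of_fibredChart`).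
THIS FILE composes the two BY NAME.

WHAT IS PROVED (4 theorems, 0 def, 0 sorry).
* ★★ `hreg_of_fibredCharts` — the binder `hreg` of the door VERBATIM (all `j < P.K`) from the door's own (I19) `hint` and, per step `j < P.K`, fibred-chart data
  `Z j, τ j, Φ j, J j, S j` of `avOfRecord F N P.K j` over `domAltOfRecord θ.ν P.K (j+1)` on the support of the β-input density with a continuous fibre integral.
* ★★★ `thm3Member_stage13SepCoPH_atDomAlt_of_fibredCharts_of_numerics_of_εreg_eq` — dag-n09-w4 g3's door with `hreg` GONE in favour of that chart data: N09-side
  inputs are then (181)ˢᵒˡ `hcov`, `hsolν` + [B11]×3 (N07), (I19) `hint`, NUMERICS, and print's (2.10) CHART DATA per step (the form in which [I] p. 267 supplies the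
  analyticity∕continuity input of p. 259).
* `mem_setOf_chi_ne_zero_of_betaInputOfRecord_ne_zero` · ★★★ `thm3Member_stage13SepCoPH_atDomAlt_of_fibredChartsOnChiSupport_of_numerics_of_εreg_eq` — the same
  door with the charted sets PINNED to the (2.9)-small-fluctuation supports `{χ^{(2.9)}_j ≠ 0}` (the support clause discharged): the chart covers only the χ-small
  fluctuations over the small-field domain — print's (2.10) setting.

HONEST FRAMING.  Count-neutral RE-SHAPING of ONE displayed hypothesis (∃ continuous version ↦ ∃ fibred chart with continuous fibre integral), kernel bookkeeping BY
NAME; the charts are NOT constructed here ([I]'s linearisation + the Haar density in the chart — K0e's M2∕M3, dag-n09-w2 g3's Euclidean engine, dag-n09-w4 g4's Haar-side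
change of variables — and N07's continuity input stay DISPLAYED); NOTHING of Bałaban's asserted ([B11] Thm 1, (I19) stay hypotheses); NO carrier re-pointed; A6: no
inhabitant at the V18∕V19 witness claimed; N09 NOT discharged; conjunct 1 (Lemma 4) and FLAG №7 untouched; K0⁷∕K1⁷ NOT closed; counts unmoved (typed 28∕28 ·
discharged 5∕27); one finite four-torus programme at fixed `ε = L^{−K}` per run — R4 closes the conditional rung `BalabanLadder.UV` only; NOT ℝ⁴ ∕ infinite volume ∕ OS;
the Yang–Mills mass gap (Clay) is NOT proved by any of this.
-/

noncomputable section

namespace Summit.QuantumFields.YangMills.BalabanUVNodes.N09HregOfFibredChartAtRecord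

open MeasureTheory Set
open scoped ENNReal NNReal
open Literature.MathematicalPhysics.QuantumFieldTheory.Balaban1983to89
open Literature.MathematicalPhysics.QuantumFieldTheory.Balaban1983to89.T4Continuum (T4Family)
open Literature.MathematicalPhysics.QuantumFieldTheory.Balaban1983to89.DagBinding (WorldP leavesP)
open Literature.MathematicalPhysics.QuantumFieldTheory.Balaban1983to89.Node00
open Literature.MathematicalPhysics.QuantumFieldTheory.Balaban1983to89.B12RTGaugeInvariance254 (liftTransf)
open Literature.MathematicalPhysics.QuantumFieldTheory.Balaban1983to89.GaugeField (gaugeAct)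
open Literature.MathematicalPhysics.QuantumFieldTheory.Balaban1983to89.ExpMeanLog (deltaSU)
open Literature.MathematicalPhysics.QuantumFieldTheory.Balaban1983to89.B12Eq019ActionBody (integrand integrand_apply)
open N09B0RiderAtRecord (thm3Member_stage13SepCoPH_atDomAlt_of_numerics_of_εreg_eq)

variable {F : T4Family} {N : ℕ} [NeZero N]

/-- ★★ **THE ANALYTIC INCLUSION `hreg` FROM PER-STEP FIBRED CHARTS.**  For a Stage-13 parameter `θ` and a run `P`: if every β-input density
`ρ_j = betaInputOfRecord (TβOfRecord₁₃) (chiβOfRecord₁₃ θ) P.K (gOfRecord₁₃ θ P) j`, `j < P.K`, is integrable ((I19) `hint`, the door's own) and the averaging of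
record `avOfRecord F N P.K j` admits, over the next step's small-field domain `domAltOfRecord θ.ν P.K (j+1)` and on a set `S j` carrying `ρ_j`, a measurable fibred
chart `Φ j` with σ-finite fibre measure `τ j`, measurable Jacobian `J j`, the change-of-variables identity and a fibre integral `V ↦ ∫ J j (V,z)·ρ_j(Φ j (V,z)) dτ j`
continuous on that domain, then `domAltOfRecord θ.ν P.K (j+1) ⊆ regSetOfRecord F N P.K j ρ_j` for every `j < P.K` — the binder `hreg` of the N09 doors VERBATIM
(`Node00.domAlt_subset_regSetOfRecord_of_fibredChart` at each step).  The charts are displayed, not constructed.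
[cite: Balaban1987RG1, p.259, (2.10) p.267 and (0.13) p.254] -/
theorem hreg_of_fibredCharts (θ : Stage13Params F N) (P : B12.RunParams)
    {Z : ℕ → Type*} [∀ j, MeasurableSpace (Z j)] (τ : ∀ j, Measure (Z j)) [∀ j, SFinite (τ j)]
    (S : ∀ j, Set (GaugeField (F.P P.K) j (SU N)))
    (Φ : ∀ j, (PBond (F.P P.K) (j + 1) → SU N) × Z j → GaugeField (F.P P.K) j (SU N))
    (J : ∀ j, (PBond (F.P P.K) (j + 1) → SU N) × Z j → ℝ≥0)
    (hint : ∀ j < P.K, Integrable (betaInputOfRecord F N (TβOfRecord₁₃ F N) (chiβOfRecord₁₃ F N θ) P.K (gOfRecord₁₃ F N θ P) j)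
      (fieldMeasure (F.P P.K) j (SU N)))
    (hS : ∀ j < P.K, ∀ x, betaInputOfRecord F N (TβOfRecord₁₃ F N) (chiβOfRecord₁₃ F N θ) P.K (gOfRecord₁₃ F N θ P) j x ≠ 0 → x ∈ S j)
    (hΦ : ∀ j, Measurable (Φ j)) (hJ : ∀ j, Measurable (J j))
    (havgΦ : ∀ j < P.K, ∀ V ∈ domAltOfRecord F N θ.ν P.K (j + 1), ∀ z, (avOfRecord F N P.K j).avg (Φ j (V, z)) = V)
    (hmap : ∀ j < P.K, (fieldMeasure (F.P P.K) j (SU N)).restrict ((avOfRecord F N P.K j).avg ⁻¹' domAltOfRecord F N θ.ν P.K (j + 1) ∩ S j)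
      = ((((piHaar (F.P P.K) (j + 1) (SU N)).restrict (domAltOfRecord F N θ.ν P.K (j + 1))).prod (τ j)).withDensity
          (fun p => (J j p : ℝ≥0∞))).map (Φ j))
    (hgc : ∀ j < P.K, ContinuousOn
      (fun V => ∫ z, (J j (V, z) : ℝ) *
        betaInputOfRecord F N (TβOfRecord₁₃ F N) (chiβOfRecord₁₃ F N θ) P.K (gOfRecord₁₃ F N θ P) j (Φ j (V, z)) ∂(τ j))
      (domAltOfRecord F N θ.ν P.K (j + 1))) :
    ∀ j < P.K, domAltOfRecord F N θ.ν P.K (j + 1) ⊆ regSetOfRecord F N P.K j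
      (betaInputOfRecord F N (TβOfRecord₁₃ F N) (chiβOfRecord₁₃ F N θ) P.K (gOfRecord₁₃ F N θ P) j) :=
  fun j hj => domAlt_subset_regSetOfRecord_of_fibredChart θ.ν hj (hint j hj) (hS j hj) (hΦ j) (hJ j) (havgΦ j hj) (hmap j hj) (hgc j hj)

/-- ★★★ **dag-n09-w4 g3's SMALL-FIELD-BOOKKEEPING DOOR WITH `hreg` REPLACED BY PER-STEP FIBRED CHARTS** (`…N09B0RiderAtRecord.thm3Member_stage13SepCoPH_atDomAlt_of_numerics_of_εreg_eq`
with `hreg := hreg_of_fibredCharts …`): N09's Theorem-3 member at the Stage-13 record from (181)ˢᵒˡ `hcov`, `hsolν` + [B11] ×3 at one radius (N07), (I19) `hint`,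
NUMERICS on the record's letters, and — in place of the analytic inclusion — DISPLAYED (2.10)-shaped chart data of the averaging of record over each
`domAltOfRecord θ.ν P.K (j+1)` on the support of the β-input with continuous fibre integrals.  CONDITIONAL; nothing of Bałaban's asserted; N09 NOT discharged.
[cite: Balaban1987RG1, Thm 3 p.264, p.259, (2.9) p.266, (2.10) p.267; Balaban1985Variational, Thm 1 (8)–(10) p.279 and (181) p.307] -/
theorem thm3Member_stage13SepCoPH_atDomAlt_of_fibredCharts_of_numerics_of_εreg_eq (θ : Stage13HParams F N) (h : θ.Provisos₁₃SepCoPH F N)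
    {w : WorldP} (hC : w.C = (datumOfRecord₁₃SepCoPH F N θ h).C) (P : B12.RunParams) (hε : 0 < θ.ε₂₉) (heq : θ.toStage13Params.ν.εreg = θ.εbg)
    (hεreg : 0 < θ.toStage13Params.ν.εreg)
    (hε3 : (143 * (((((F.P P.K).d + 4 : ℕ) : ℝ)) ^ 2 / 4) ^ 2) * θ.toStage13Params.ν.εreg ≤ 1 / 3)
    (hε2 : 2 * θ.toStage13Params.ν.εreg ≤ 2 * deltaSU (Fin N) / ((((F.P P.K).d + 4) * (F.P P.K).L : ℕ) : ℝ) ^ 2)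
    (hord : 2 * θ.toStage13Params.ν.εreg / ((F.P P.K).L : ℝ) ^ 2 +
      4 * max θ.toStage13Params.ε₂₉ (10 * (((((F.P P.K).d + 2) * (F.P P.K).L : ℕ) : ℝ) * θ.toStage13Params.ε₂₉) * ((F.P P.K).L : ℝ) ^ ((F.P P.K).d - 1)) ≤
        θ.toStage13Params.ν.ε₀)
    (hn1 : 1640 * (2 * (((((F.P P.K).d + 2) * (F.P P.K).L : ℕ) : ℝ) * θ.toStage13Params.ε₂₉) +
        ((((F.P P.K).d + 2) * (F.P P.K).L : ℕ) : ℝ) ^ 2 / 4 * (2 * θ.toStage13Params.ν.εreg / ((F.P P.K).L : ℝ) ^ 2)) *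
          (((F.P P.K).L : ℝ) ^ ((F.P P.K).d - 1)) ^ 2 ≤ 1)
    (hn2 : 13 * (2 * (((((F.P P.K).d + 2) * (F.P P.K).L : ℕ) : ℝ) * θ.toStage13Params.ε₂₉) +
        ((((F.P P.K).d + 2) * (F.P P.K).L : ℕ) : ℝ) ^ 2 / 4 * (2 * θ.toStage13Params.ν.εreg / ((F.P P.K).L : ℝ) ^ 2)) *
          ((F.P P.K).L : ℝ) ^ ((F.P P.K).d - 1) < deltaSU (Fin N))
    (hcov : ∀ j < P.K, ∀ (v : GaugeTransf (F.P P.K) (j + 1) (SU N)) (W : GaugeField (F.P P.K) (j + 1) (SU N)),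
      UkExists F N P.K (j + 1) θ.toStage13Params.ν.εreg W →
        critCfgOfRecord F N θ.toStage13Params.ν P.K j (gaugeAct v W) = gaugeAct (liftTransf v) (critCfgOfRecord F N θ.toStage13Params.ν P.K j W))
    (hsolν : ∀ j < P.K, ∀ W ∈ domAltOfRecord F N θ.ν P.K (j + 1), UkExists F N P.K (j + 1) θ.toStage13Params.ν.εreg W)
    (hint : ∀ j < P.K, Integrable (betaInputOfRecord F N (TβOfRecord₁₃ F N) (chiβOfRecord₁₃ F N θ.toStage13Params) P.K (gOfRecord₁₃ F N θ.toStage13Params P) j)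
      (fieldMeasure (F.P P.K) j (SU N)))
    {Z : ℕ → Type*} [∀ j, MeasurableSpace (Z j)] (τ : ∀ j, Measure (Z j)) [∀ j, SFinite (τ j)]
    (S : ∀ j, Set (GaugeField (F.P P.K) j (SU N)))
    (Φ : ∀ j, (PBond (F.P P.K) (j + 1) → SU N) × Z j → GaugeField (F.P P.K) j (SU N))
    (J : ∀ j, (PBond (F.P P.K) (j + 1) → SU N) × Z j → ℝ≥0)
    (hS : ∀ j < P.K, ∀ x,
      betaInputOfRecord F N (TβOfRecord₁₃ F N) (chiβOfRecord₁₃ F N θ.toStage13Params) P.K (gOfRecord₁₃ F N θ.toStage13Params P) j x ≠ 0 → x ∈ S j)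
    (hΦ : ∀ j, Measurable (Φ j)) (hJ : ∀ j, Measurable (J j))
    (havgΦ : ∀ j < P.K, ∀ V ∈ domAltOfRecord F N θ.ν P.K (j + 1), ∀ z, (avOfRecord F N P.K j).avg (Φ j (V, z)) = V)
    (hmap : ∀ j < P.K, (fieldMeasure (F.P P.K) j (SU N)).restrict ((avOfRecord F N P.K j).avg ⁻¹' domAltOfRecord F N θ.ν P.K (j + 1) ∩ S j)
      = ((((piHaar (F.P P.K) (j + 1) (SU N)).restrict (domAltOfRecord F N θ.ν P.K (j + 1))).prod (τ j)).withDensity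
          (fun p => (J j p : ℝ≥0∞))).map (Φ j))
    (hgc : ∀ j < P.K, ContinuousOn
      (fun V => ∫ z, (J j (V, z) : ℝ) *
        betaInputOfRecord F N (TβOfRecord₁₃ F N) (chiβOfRecord₁₃ F N θ.toStage13Params) P.K (gOfRecord₁₃ F N θ.toStage13Params P) j (Φ j (V, z)) ∂(τ j))
      (domAltOfRecord F N θ.ν P.K (j + 1)))
    (h11 : ∀ k, k ≤ P.K → ∀ V ∈ domAltOfRecord F N θ.ν P.K k, UkExists F N P.K k θ.εbg V ∧ UniqueUkOrbit F N P.K k θ.εbg V)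
    (hres : ∀ k, k ≤ P.K → HRestrict F N θ.εbg P.K k (domAltOfRecord F N θ.ν P.K k))
    (huniq : ∀ k, k ≤ P.K → ∀ V ∈ domAltOfRecord F N θ.ν P.K k, ∀ j < k,
      UniqueUkOrbit F N P.K (j + 1) θ.εbg (Averaging.iter (avOfRecord F N P.K) (j + 1) (Uk F N P.K k θ.εbg V))) :
    (leavesP w P).smallCouplings → (leavesP w P).smallFieldInductive :=
  thm3Member_stage13SepCoPH_atDomAlt_of_numerics_of_εreg_eq θ h hC P hε heq hεreg hε3 hε2 hord hn1 hn2 hcov hsolν hint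
    (hreg_of_fibredCharts θ.toStage13Params P τ S Φ J hint hS hΦ hJ havgΦ hmap hgc) h11 hres huniq

/-- The β-input density `χ_k·exp[−GF∕g_k² + A_k]` vanishes wherever its small-field factor `χ_k` does: its support lies in the (2.9)-small-fluctuation set
`{χ_k ≠ 0}` — the natural charted set `S` for the fibred charts (print's (2.10) substitution parametrises exactly the χ-small fluctuations around the background).
[cite: Balaban1987RG1, (0.19) p.255 and (2.9)–(2.10) pp.266–267] -/
theorem mem_setOf_chi_ne_zero_of_betaInputOfRecord_ne_zero (T : Transport F N) (χ : (K : ℕ) → (ℕ → ℝ) → (k : ℕ) → Density (F.P K) k (SU N))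
    (K : ℕ) (g : ℕ → ℝ) (k : ℕ) (U : GaugeField (F.P K) k (SU N)) (h : betaInputOfRecord F N T χ K g k U ≠ 0) :
    U ∈ {U | χ K g k U ≠ 0} := by
  intro h0
  apply h
  show integrand (χ K g k) (gfOfRecord F N K k) (g k) (effActionHT F N T χ K g k) U = 0
  rw [integrand_apply, h0, zero_mul]

/-- ★★★ **THE SAME DOOR WITH THE CHARTED SETS PINNED TO THE (2.9)-SMALL-FLUCTUATION SUPPORTS** `S j := {U | χ^{(2.9)}_j(U) ≠ 0}` (`chiβOfRecord₁₃ θ`, the record's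
β-slot χ): the support clause `hS` of `thm3Member_stage13SepCoPH_atDomAlt_of_fibredCharts_of_numerics_of_εreg_eq` is then a theorem
(`mem_setOf_chi_ne_zero_of_betaInputOfRecord_ne_zero`), so the displayed chart of `avOfRecord F N P.K j` need only cover the χ-SMALL FLUCTUATIONS over the small-field
domain `domAltOfRecord θ.ν P.K (j+1)` — print's (2.10) setting verbatim («configurations `e^{iB′}V^{(k)}(W)` with `|B′| < ε₁`»).  CONDITIONAL; nothing of Bałaban's
asserted; N09 NOT discharged. [cite: Balaban1987RG1, Thm 3 p.264, p.259, (2.9) p.266, (2.10) p.267; Balaban1985Variational, Thm 1 (8)–(10) p.279 and (181) p.307] -/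
theorem thm3Member_stage13SepCoPH_atDomAlt_of_fibredChartsOnChiSupport_of_numerics_of_εreg_eq (θ : Stage13HParams F N) (h : θ.Provisos₁₃SepCoPH F N)
    {w : WorldP} (hC : w.C = (datumOfRecord₁₃SepCoPH F N θ h).C) (P : B12.RunParams) (hε : 0 < θ.ε₂₉) (heq : θ.toStage13Params.ν.εreg = θ.εbg)
    (hεreg : 0 < θ.toStage13Params.ν.εreg)
    (hε3 : (143 * (((((F.P P.K).d + 4 : ℕ) : ℝ)) ^ 2 / 4) ^ 2) * θ.toStage13Params.ν.εreg ≤ 1 / 3)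
    (hε2 : 2 * θ.toStage13Params.ν.εreg ≤ 2 * deltaSU (Fin N) / ((((F.P P.K).d + 4) * (F.P P.K).L : ℕ) : ℝ) ^ 2)
    (hord : 2 * θ.toStage13Params.ν.εreg / ((F.P P.K).L : ℝ) ^ 2 +
      4 * max θ.toStage13Params.ε₂₉ (10 * (((((F.P P.K).d + 2) * (F.P P.K).L : ℕ) : ℝ) * θ.toStage13Params.ε₂₉) * ((F.P P.K).L : ℝ) ^ ((F.P P.K).d - 1)) ≤
        θ.toStage13Params.ν.ε₀)
    (hn1 : 1640 * (2 * (((((F.P P.K).d + 2) * (F.P P.K).L : ℕ) : ℝ) * θ.toStage13Params.ε₂₉) +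
        ((((F.P P.K).d + 2) * (F.P P.K).L : ℕ) : ℝ) ^ 2 / 4 * (2 * θ.toStage13Params.ν.εreg / ((F.P P.K).L : ℝ) ^ 2)) *
          (((F.P P.K).L : ℝ) ^ ((F.P P.K).d - 1)) ^ 2 ≤ 1)
    (hn2 : 13 * (2 * (((((F.P P.K).d + 2) * (F.P P.K).L : ℕ) : ℝ) * θ.toStage13Params.ε₂₉) +
        ((((F.P P.K).d + 2) * (F.P P.K).L : ℕ) : ℝ) ^ 2 / 4 * (2 * θ.toStage13Params.ν.εreg / ((F.P P.K).L : ℝ) ^ 2)) *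
          ((F.P P.K).L : ℝ) ^ ((F.P P.K).d - 1) < deltaSU (Fin N))
    (hcov : ∀ j < P.K, ∀ (v : GaugeTransf (F.P P.K) (j + 1) (SU N)) (W : GaugeField (F.P P.K) (j + 1) (SU N)),
      UkExists F N P.K (j + 1) θ.toStage13Params.ν.εreg W →
        critCfgOfRecord F N θ.toStage13Params.ν P.K j (gaugeAct v W) = gaugeAct (liftTransf v) (critCfgOfRecord F N θ.toStage13Params.ν P.K j W))
    (hsolν : ∀ j < P.K, ∀ W ∈ domAltOfRecord F N θ.ν P.K (j + 1), UkExists F N P.K (j + 1) θ.toStage13Params.ν.εreg W)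
    (hint : ∀ j < P.K, Integrable (betaInputOfRecord F N (TβOfRecord₁₃ F N) (chiβOfRecord₁₃ F N θ.toStage13Params) P.K (gOfRecord₁₃ F N θ.toStage13Params P) j)
      (fieldMeasure (F.P P.K) j (SU N)))
    {Z : ℕ → Type*} [∀ j, MeasurableSpace (Z j)] (τ : ∀ j, Measure (Z j)) [∀ j, SFinite (τ j)]
    (Φ : ∀ j, (PBond (F.P P.K) (j + 1) → SU N) × Z j → GaugeField (F.P P.K) j (SU N))
    (J : ∀ j, (PBond (F.P P.K) (j + 1) → SU N) × Z j → ℝ≥0)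
    (hΦ : ∀ j, Measurable (Φ j)) (hJ : ∀ j, Measurable (J j))
    (havgΦ : ∀ j < P.K, ∀ V ∈ domAltOfRecord F N θ.ν P.K (j + 1), ∀ z, (avOfRecord F N P.K j).avg (Φ j (V, z)) = V)
    (hmap : ∀ j < P.K, (fieldMeasure (F.P P.K) j (SU N)).restrict ((avOfRecord F N P.K j).avg ⁻¹' domAltOfRecord F N θ.ν P.K (j + 1) ∩
        {U | chiβOfRecord₁₃ F N θ.toStage13Params P.K (gOfRecord₁₃ F N θ.toStage13Params P) j U ≠ 0})
      = ((((piHaar (F.P P.K) (j + 1) (SU N)).restrict (domAltOfRecord F N θ.ν P.K (j + 1))).prod (τ j)).withDensity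
          (fun p => (J j p : ℝ≥0∞))).map (Φ j))
    (hgc : ∀ j < P.K, ContinuousOn
      (fun V => ∫ z, (J j (V, z) : ℝ) *
        betaInputOfRecord F N (TβOfRecord₁₃ F N) (chiβOfRecord₁₃ F N θ.toStage13Params) P.K (gOfRecord₁₃ F N θ.toStage13Params P) j (Φ j (V, z)) ∂(τ j))
      (domAltOfRecord F N θ.ν P.K (j + 1)))
    (h11 : ∀ k, k ≤ P.K → ∀ V ∈ domAltOfRecord F N θ.ν P.K k, UkExists F N P.K k θ.εbg V ∧ UniqueUkOrbit F N P.K k θ.εbg V)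
    (hres : ∀ k, k ≤ P.K → HRestrict F N θ.εbg P.K k (domAltOfRecord F N θ.ν P.K k))
    (huniq : ∀ k, k ≤ P.K → ∀ V ∈ domAltOfRecord F N θ.ν P.K k, ∀ j < k,
      UniqueUkOrbit F N P.K (j + 1) θ.εbg (Averaging.iter (avOfRecord F N P.K) (j + 1) (Uk F N P.K k θ.εbg V))) :
    (leavesP w P).smallCouplings → (leavesP w P).smallFieldInductive :=
  thm3Member_stage13SepCoPH_atDomAlt_of_fibredCharts_of_numerics_of_εreg_eq θ h hC P hε heq hεreg hε3 hε2 hord hn1 hn2 hcov hsolν hint τ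
    (fun j => {U | chiβOfRecord₁₃ F N θ.toStage13Params P.K (gOfRecord₁₃ F N θ.toStage13Params P) j U ≠ 0}) Φ J
    (fun _ _ U hU => mem_setOf_chi_ne_zero_of_betaInputOfRecord_ne_zero _ _ _ _ _ U hU) hΦ hJ havgΦ hmap hgc h11 hres huniq

end Summit.QuantumFields.YangMills.BalabanUVNodes.N09HregOfFibredChartAtRecord

end
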